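import Summits.CriticalPhenomena.PercolationContinuityZ3.Theorems.PercNearOneGluingNoHeavyLowerTailAntitheticEarSpanDom
import HarnessLib

/-!
# `NoHeavyLowerTail` (stmt-CriticalPhenomena-4575) — antithetic cluster pairs: RED DOMINATION of the cycle + ear boxes, P beyond the ear
# (THEOREM Θ², HOME/MEMO-gen63.md §3; prim-hp-2 gen 63)

Support file (`--supports stmt-CriticalPhenomena-4575`, hull-port prover `prim-hp-2`, gen 63).  No definitions, no named facts, no sorries;
standard axioms.  Setting of …AntitheticEarFarBoxes: cycle `v`, ear `u 0 = v α, …, u ℓ = v β`, `E = Cyc.edgeSet n v ∪ Cyc.edgeSet ℓ u`,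
`P = v p` with `α < β ≤ p < n` and not `(α = 0 ∧ p = β)`; boxes described by index data `(rd, bl, er)` (…AntitheticEarBoxKit).  The three
families with a fixed-blue pair are red-dominated, by the index-level shielding criterion `Cyc.dbox_dom`:
* `Cyc.dom_far_cell` — CELL `k` (`p ≤ k < n`): `edge v k` blue, `[0,k)` red, ear free (if `k = β = p` the free ear hangs at the red end
  `v k`; its other end `v α` is sealed by the red pairs `α - 1`, `α` — this is where `α ≥ 1` is needed when `p = β`);
* `Cyc.dom_far_FN` — FN `j k` (`1 ≤ α ≤ j < β`, `p ≤ k < n`): ear red, `[0,j) ∪ [β,k)` red, `edge v j`, `edge v k` blue;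
* `Cyc.dom_far_FZ` — FZ `j k` (`α = 0`, `j < β < p ≤ k < n`): ear red, `(j,k)` red, `edge v j`, `edge v k` blue.
Machine check of the scheme: lab/cycle_ear_scheme.py (all `n ≤ 9`: exact domination).
[cite: VandenbergHaggstromKahn2005, §1 p. 3 (open cluster `C_s`)]
-/

noncomputable section

namespace Summit.CriticalPhenomena.PercolationContinuityZ3.Theorems

open Literature.Probability.Percolation
open scoped Classical

namespace Antithetic

namespace Cyc

variable {V : Type*} {n : ℕ} {v : ℕ → V} {ℓ : ℕ} {u : ℕ → V} {α β p : ℕ}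
  (rd bl : ℕ → Prop) (er : Prop) (Fix N : Set (Sym2 V))
  (hFix : ∀ e, e ∈ Fix ↔ (∃ i, i < n ∧ (rd i ∨ bl i) ∧ e = edge v i) ∨ (er ∧ ∃ m, m < ℓ ∧ e = edge u m))
  (hN : ∀ e, e ∈ N ↔ (∃ i, i < n ∧ rd i ∧ e = edge v i) ∨ (er ∧ ∃ m, m < ℓ ∧ e = edge u m))
  (hn : 3 ≤ n) (hinj : ∀ i j, i < n → j < n → v i = v j → i = j) (hper : v n = v 0) (hℓ : 1 ≤ ℓ)
  (hαβ : α < β) (hβp : β ≤ p) (hpn : p < n) (hu0 : u 0 = v α) (huℓ : u ℓ = v β)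
  (hfresh : ∀ j, 0 < j → j < ℓ → ∀ i, i ≤ n → u j ≠ v i) (huinj : ∀ i j, i ≤ ℓ → j ≤ ℓ → u i = u j → i = j)
  (hRC : ∀ m, m < ℓ → ∀ i, i < n → edge u m ≠ edge v i)
include hFix hN hn hinj hper hℓ hαβ hβp hpn hu0 huℓ hfresh huinj hRC

/-- **CELL `k` is red-dominated** (`p ≤ k < n`: `edge v k` blue, `[0,k)` red, `(k,n)` and the ear free; not `α = 0 ∧ p = β`). [this work] -/
theorem dom_far_cell (hexc : ¬ (α = 0 ∧ p = β)) {k : ℕ} (hpk : p ≤ k) (hkn : k < n)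
    (hrd : ∀ i, rd i ↔ i < k) (hbl : ∀ i, bl i ↔ i = k)
    {T T' : Set (Sym2 V)} (hT : ∀ e ∈ Fix, (e ∈ T ↔ e ∈ N)) (hT' : ∀ e ∈ Fix, (e ∈ T' ↔ e ∈ N))
    (hflip : ∀ e ∉ Fix, (e ∈ T' ↔ e ∉ T)) :
    openCluster (T'ᶜ ∩ (edgeSet n v ∪ edgeSet ℓ u)) (v 0) ⊆ openCluster (T ∩ (edgeSet n v ∪ edgeSet ℓ u)) (v 0) := by
  refine dbox_dom hn hinj hper hRC rd bl er Fix N hFix hN (fun k' hk'n hblk' => ?_) hT hT' hflip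
  obtain rfl : k' = k := (hbl k').1 hblk'
  constructor
  · by_cases hkn1 : k' + 1 = n
    · left; rw [hkn1, hper]; exact mem_openCluster_self _ _
    right
    -- the component of `v k` in the shielding graph of `v (k+1)`: itself, plus the free ear and `v α` if `k = β`
    refine not_mem_cluster_of_closed _ (v 0) (v k')
      ({x | ∃ i, i ≤ n ∧ (i = k' ∨ (β = k' ∧ i = α)) ∧ x = v i} ∪ {x | ∃ j, 0 < j ∧ j < ℓ ∧ (β = k') ∧ x = u j}) ?_ ?_ ?_
    · exact (mem_idxSet_v hinj hper hn hfresh _ _ (by omega) (by omega)).2 (Or.inl rfl)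
    · exact fun h => absurd ((mem_idxSet_v hinj hper hn hfresh _ _ (by omega) (Nat.zero_le n)).1 h) (by omega)
    · refine ear_closed_of_idx hn hinj hper hℓ (by omega) (by omega) hu0 huℓ hfresh huinj _ (fun e he => he.1) _ _ (by omega)
        (fun i hin => ?_) (fun _ _ _ => Or.inl Iff.rfl) (fun _ => Or.inl (by omega)) (fun _ => Or.inl (by omega))
        (fun _ => Or.inl (by omega))
      by_cases hik : i = k'
      · exact Or.inr (hik ▸ dbox_notG_touch Fix N _ (Or.inr rfl))
      by_cases hki : i < k'
      · exact Or.inr (dbox_notG_red rd bl er Fix N hFix hN _ hin ((hrd i).2 hki))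
      · exact Or.inl (by omega)
  · -- `v k` lies in the red core: the arc `[0,k)` from `s`
    left
    exact dbox_core_reach rd bl er Fix N hFix hN (Nat.zero_le k') hkn.le fun i _ hi => (hrd i).2 hi

/-- **FN `j k` is red-dominated** (ear red, `[0,j) ∪ [β,k)` red, `edge v j`, `edge v k` blue; `1 ≤ α ≤ j < β ≤ p ≤ k < n`). [this work] -/
theorem dom_far_FN {j k : ℕ} (hα1 : 1 ≤ α) (hαj : α ≤ j) (hjβ : j < β) (hpk : p ≤ k) (hkn : k < n)
    (hrd : ∀ i, rd i ↔ (i < j ∨ (β ≤ i ∧ i < k))) (hbl : ∀ i, bl i ↔ (i = j ∨ i = k)) (her : er)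
    {T T' : Set (Sym2 V)} (hT : ∀ e ∈ Fix, (e ∈ T ↔ e ∈ N)) (hT' : ∀ e ∈ Fix, (e ∈ T' ↔ e ∈ N))
    (hflip : ∀ e ∉ Fix, (e ∈ T' ↔ e ∉ T)) :
    openCluster (T'ᶜ ∩ (edgeSet n v ∪ edgeSet ℓ u)) (v 0) ⊆ openCluster (T ∩ (edgeSet n v ∪ edgeSet ℓ u)) (v 0) := by
  -- the red core contains `v i` for `i ≤ j` (in particular `v α`), `v β` (ear) and the run `[β, k]`
  have hlo : ∀ i, i ≤ j → v i ∈ openCluster (N ∩ Fix ∩ (edgeSet n v ∪ edgeSet ℓ u)) (v 0) := fun i hi =>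
    dbox_core_reach rd bl er Fix N hFix hN (Nat.zero_le i) (by omega) fun i' _ hi' => (hrd i').2 (Or.inl (by omega))
  have hβ : v β ∈ openCluster (N ∩ Fix ∩ (edgeSet n v ∪ edgeSet ℓ u)) (v 0) := by
    have h := dbox_core_reach_ear rd bl er Fix N hFix hN her
    rw [hu0, huℓ] at h
    exact (hlo α hαj).trans h
  refine dbox_dom hn hinj hper hRC rd bl er Fix N hFix hN (fun k' hk'n hblk' => ?_) hT hT' hflip
  rcases (hbl k').1 hblk' with rfl | rfl
  · -- the blue pair `j`: red end `v j`, free end `v (j+1)` (unless `j + 1 = β`)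
    constructor
    · by_cases hjβ1 : k' + 1 = β
      · left; rw [hjβ1]; exact hβ
      right
      refine not_mem_cluster_of_closed _ (v 0) (v k')
        ({x | ∃ i, i ≤ n ∧ i = k' ∧ x = v i} ∪ {x | ∃ j, 0 < j ∧ j < ℓ ∧ False ∧ x = u j}) ?_ ?_ ?_
      · exact (mem_idxSet_v hinj hper hn hfresh _ (fun _ => False) (by omega) (by omega)).2 rfl
      · exact fun h => absurd ((mem_idxSet_v hinj hper hn hfresh _ (fun _ => False) (by omega) (Nat.zero_le n)).1 h) (by omega)
      · refine ear_closed_of_idx hn hinj hper hℓ (by omega) (by omega) hu0 huℓ hfresh huinj _ (fun e he => he.1) _ _ (by omega)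
          (fun i hin => ?_) (fun _ _ _ => Or.inl Iff.rfl)
          (fun hℓ2 => Or.inr (dbox_notG_ear rd bl er Fix N hFix hN _ her (by omega)))
          (fun hℓ2 => Or.inr (dbox_notG_ear rd bl er Fix N hFix hN _ her (by omega)))
          (fun hℓ1 => Or.inr (dbox_notG_ear rd bl er Fix N hFix hN _ her (by omega)))
        by_cases h1 : i = k'
        · exact Or.inr (h1 ▸ dbox_notG_touch Fix N _ (Or.inr rfl))
        by_cases h2 : i + 1 = k'
        · exact Or.inr (dbox_notG_red rd bl er Fix N hFix hN _ hin ((hrd _).2 (Or.inl (by omega))))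
        · exact Or.inl (by omega)
    · left; exact hlo k' le_rfl
  · -- the blue pair `k`: red end `v k` (towards `v β`), free end `v (k+1)` (unless it is `s = v n`); if `k = β` the component of `v k`
    -- in the shielding graph runs down the free part `(j, β)` of the middle arc and stops at the blue pair `j`
    constructor
    · by_cases hkn1 : k' + 1 = n
      · left; rw [hkn1, hper]; exact mem_openCluster_self _ _
      right
      refine not_mem_cluster_of_closed _ (v 0) (v k')
        ({x | ∃ i, i ≤ n ∧ (i = k' ∨ (k' = β ∧ j ≤ i ∧ i ≤ β)) ∧ x = v i} ∪ {x | ∃ j, 0 < j ∧ j < ℓ ∧ False ∧ x = u j}) ?_ ?_ ?_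
      · exact (mem_idxSet_v hinj hper hn hfresh _ (fun _ => False) (by omega) (by omega)).2 (Or.inl rfl)
      · exact fun h => absurd ((mem_idxSet_v hinj hper hn hfresh _ (fun _ => False) (by omega) (Nat.zero_le n)).1 h) (by omega)
      · refine ear_closed_of_idx hn hinj hper hℓ (by omega) (by omega) hu0 huℓ hfresh huinj _ (fun e he => he.1) _ _ (by omega)
          (fun i hin => ?_) (fun _ _ _ => Or.inl Iff.rfl)
          (fun hℓ2 => Or.inr (dbox_notG_ear rd bl er Fix N hFix hN _ her (by omega)))
          (fun hℓ2 => Or.inr (dbox_notG_ear rd bl er Fix N hFix hN _ her (by omega)))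
          (fun hℓ1 => Or.inr (dbox_notG_ear rd bl er Fix N hFix hN _ her (by omega)))
        by_cases h1 : i = k'
        · exact Or.inr (h1 ▸ dbox_notG_touch Fix N _ (Or.inr rfl))
        by_cases h2 : i < j ∨ (β ≤ i ∧ i < k')
        · exact Or.inr (dbox_notG_red rd bl er Fix N hFix hN _ hin ((hrd _).2 h2))
        · exact Or.inl (by constructor <;> intro h <;> omega)
    · left
      exact hβ.trans (dbox_core_reach rd bl er Fix N hFix hN (by omega : β ≤ k') hkn.le
        fun i hβi hik => (hrd i).2 (Or.inr ⟨hβi, hik⟩))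

omit hβp in
/-- **FZ `j k` is red-dominated** (ear AT `s`: `α = 0`; ear red, `(j,k)` red, `edge v j`, `edge v k` blue; `j < β < p ≤ k < n`). [this work] -/
theorem dom_far_FZ {j k : ℕ} (hα0 : α = 0) (hjβ : j < β) (hβp' : β < p) (hpk : p ≤ k) (hkn : k < n)
    (hrd : ∀ i, rd i ↔ (j < i ∧ i < k)) (hbl : ∀ i, bl i ↔ (i = j ∨ i = k)) (her : er)
    {T T' : Set (Sym2 V)} (hT : ∀ e ∈ Fix, (e ∈ T ↔ e ∈ N)) (hT' : ∀ e ∈ Fix, (e ∈ T' ↔ e ∈ N))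
    (hflip : ∀ e ∉ Fix, (e ∈ T' ↔ e ∉ T)) :
    openCluster (T'ᶜ ∩ (edgeSet n v ∪ edgeSet ℓ u)) (v 0) ⊆ openCluster (T ∩ (edgeSet n v ∪ edgeSet ℓ u)) (v 0) := by
  -- the red core contains `v β` (the ear from `s = v α`) and the run `(j, k]` around it
  have hβ : v β ∈ openCluster (N ∩ Fix ∩ (edgeSet n v ∪ edgeSet ℓ u)) (v 0) := by
    have h := dbox_core_reach_ear rd bl er Fix N hFix hN her
    rw [hu0, huℓ, hα0] at h
    exact h
  refine dbox_dom hn hinj hper hRC rd bl er Fix N hFix hN (fun k' hk'n hblk' => ?_) hT hT' hflip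
  rcases (hbl k').1 hblk' with rfl | rfl
  · -- the blue pair `j`: red end `v (j+1)` (towards `v β`), free end `v j` (unless `j = 0`)
    constructor
    · left
      exact hβ.trans (dbox_core_reach rd bl er Fix N hFix hN (by omega : k' + 1 ≤ β) (by omega)
        fun i hi hiβ => (hrd i).2 ⟨by omega, by omega⟩).symm
    · by_cases hj0 : k' = 0
      · left; rw [hj0]; exact mem_openCluster_self _ _
      right
      refine not_mem_cluster_of_closed _ (v 0) (v (k' + 1))
        ({x | ∃ i, i ≤ n ∧ i = k' + 1 ∧ x = v i} ∪ {x | ∃ j, 0 < j ∧ j < ℓ ∧ False ∧ x = u j}) ?_ ?_ ?_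
      · exact (mem_idxSet_v hinj hper hn hfresh _ (fun _ => False) (by omega) (by omega)).2 rfl
      · exact fun h => absurd ((mem_idxSet_v hinj hper hn hfresh _ (fun _ => False) (by omega) (Nat.zero_le n)).1 h) (by omega)
      · refine ear_closed_of_idx hn hinj hper hℓ (by omega) (by omega) hu0 huℓ hfresh huinj _ (fun e he => he.1) _ _ (by omega)
          (fun i hin => ?_) (fun _ _ _ => Or.inl Iff.rfl)
          (fun hℓ2 => Or.inr (dbox_notG_ear rd bl er Fix N hFix hN _ her (by omega)))
          (fun hℓ2 => Or.inr (dbox_notG_ear rd bl er Fix N hFix hN _ her (by omega)))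
          (fun hℓ1 => Or.inr (dbox_notG_ear rd bl er Fix N hFix hN _ her (by omega)))
        by_cases h1 : i = k'
        · exact Or.inr (h1 ▸ dbox_notG_touch Fix N _ (Or.inl rfl))
        by_cases h2 : i = k' + 1
        · exact Or.inr (h2 ▸ dbox_notG_red rd bl er Fix N hFix hN _ (by omega) ((hrd _).2 ⟨by omega, by omega⟩))
        · exact Or.inl (by omega)
  · -- the blue pair `k`: red end `v k` (towards `v β`), free end `v (k+1)` (unless it is `s = v n`)
    constructor
    · by_cases hkn1 : k' + 1 = n
      · left; rw [hkn1, hper]; exact mem_openCluster_self _ _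
      right
      refine not_mem_cluster_of_closed _ (v 0) (v k')
        ({x | ∃ i, i ≤ n ∧ i = k' ∧ x = v i} ∪ {x | ∃ j, 0 < j ∧ j < ℓ ∧ False ∧ x = u j}) ?_ ?_ ?_
      · exact (mem_idxSet_v hinj hper hn hfresh _ (fun _ => False) (by omega) (by omega)).2 rfl
      · exact fun h => absurd ((mem_idxSet_v hinj hper hn hfresh _ (fun _ => False) (by omega) (Nat.zero_le n)).1 h) (by omega)
      · refine ear_closed_of_idx hn hinj hper hℓ (by omega) (by omega) hu0 huℓ hfresh huinj _ (fun e he => he.1) _ _ (by omega)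
          (fun i hin => ?_) (fun _ _ _ => Or.inl Iff.rfl)
          (fun hℓ2 => Or.inr (dbox_notG_ear rd bl er Fix N hFix hN _ her (by omega)))
          (fun hℓ2 => Or.inr (dbox_notG_ear rd bl er Fix N hFix hN _ her (by omega)))
          (fun hℓ1 => Or.inr (dbox_notG_ear rd bl er Fix N hFix hN _ her (by omega)))
        by_cases h1 : i = k'
        · exact Or.inr (h1 ▸ dbox_notG_touch Fix N _ (Or.inr rfl))
        by_cases h2 : i + 1 = k'
        · exact Or.inr (dbox_notG_red rd bl er Fix N hFix hN _ hin ((hrd _).2 ⟨by omega, by omega⟩))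
        · exact Or.inl (by omega)
    · left
      exact hβ.trans (dbox_core_reach rd bl er Fix N hFix hN (by omega : β ≤ k') hkn.le
        fun i hβi hik => (hrd i).2 ⟨by omega, hik⟩)

end Cyc

end Antithetic

end Summit.CriticalPhenomena.PercolationContinuityZ3.Theorems
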